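import Summits.QuantumFields.BalabanUV.T4Continuum.Support.VariationalColourTaxiLines
import Summits.QuantumFields.BalabanUV.T4Continuum.Support.VariationalVectorOneStepRepair

/-!
# T⁴ programme, spine node NE2 (U1a), lane P2 — «V-COL-TAXI», part 4: THE `hONE` BINDER OF THE VECTOR BRACKET AT BAŁABAN's TAXI DATA — leaf-01-g6's V-ONE for
# general line transports (`blockSpin_QT_le`) with Bałaban's product line transports, taxi frames and the straight coarsening: the line-vs-frame distance,
# the frame defects and the coarse plaquette defect ALL discharged from the operator plaquette defect; leaf V-UB for the carrier stays DISPLAYED (`hUB1`)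

NE2 formalisation swarm `b2b-balaban-t4-ne2-formalise-*`, leaf prover 04 GEN 4 (`prover-b2b-balaban-t4-ne2-formalise-leaf-04-g4-0`); register row «P2-sup» of
`t4/formal/NE2/LEAVES.md`; journal CLAIMS.log «V-COL-TAXI part 4».  Composition BY NAME of leaf-01-g6's `VariationalVectorOneStepRepair.blockSpin_QT_le` (V-ONE-1F file 6,
p219957: «for Bałaban's contour-and-line transports `γ` is a holonomy defect … the taxi ∕ CLASS lineage's number, NOT supplied here») with this unit's suppliers
`VariationalColourTaxiLines.{lineT_taxi_own_sub_le, lineT_taxi_spill_sub_le, hin_taxiTv_le, hcross_taxiTv_le, coarseTv_plaq_le}` (p219787).  The leaf-V-UB hypothesis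
`hUB1` of `blockSpin_QT_le` (V-UB for the ACTUAL carrier) stays DISPLAYED in the tree's shape; at taxi data it is discharged, with NO gauge condition, by the
frame-relative V-UB-L (leaf-03-g4's `VectorLineTransportFrame`, journal l.14413 ∕ this unit's withdrawn twin l.14587) composed with §1 — a sequel one-liner.

THE DATA (coarse level `n`, one step of factor `L`, fine torus `Tor (fine L (fine n M))`; `E` a finite-dimensional Hilbert space): UNITARY fine bond operators `R′`
with operator plaquette defect `≤ a`; frames `U′ := taxiTv R′`, coarse bonds `Rc := coarseTv R′`, carrier `Q_T` with `T := lineT (taxiTv R′) R′` (Bałaban's product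
line transports, [Balaban1985AveragingOperations] (125) ∕ [Balaban1985BackgroundPropagators] (3.13) SHAPES); `G ≥ 0`, `G′ ≥ 0` with (GF1′) `G′ ≤ C_G·rough′ + C₀·Σ‖·‖²`.
 * §1 **`lineT_sub_frameT_taxi_le`**: `‖lineT (taxiTv R′) R′ (y,j,t,ν) − frameT (taxiTv R′) (coarseTv R′) (y,j,t,ν)‖ ≤ 3(d−1)L(L−1)·a` (own ∕ spill cases of part 2);
 * §2 **`blockSpin_lineT_taxi_le_of_ub`** = `blockSpin_QT_le` AT TAXI DATA: with `p := L²a`, `m := (d−1)(L−1)(2L−1)a`, `γ := 3(d−1)L(L−1)a` and a DISPLAYED leaf V-UB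
   `hUB1 : ∀ r, ∃ g, QvL T g = r ∧ ScV L (fine n M) R′ G′ g ≤ Λ₁·nsqV r` for the carrier `T := lineT (taxiTv R′) R′`:
   `blockSpin (QvL L (fine n M) T) (SfV n L M R′ 0) W ≤ ( √(ScV n M Rc G W + 4(d+26)(L∕n²)·ρ_V W) + (nL√(d(50p²∕L + (32(1+d²)+400)m²)∕2) + nγ√(Λ₁(4(1+d²)+50)))·√(qWV n M W) )²`
   — the `hONE` binder of `VariationalVectorForm.vector_pair_bracket_sqrt` for the pure curl form and Bałaban's carrier, transport hypotheses = unitarity and the plaquette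
   defect only.  Honest sizes under the scale-invariant class `(nL)²a ≤ c`: `nL·m, nL·p, n·γ = O(d·L·c∕n)` — geometric along the tower.
WHAT IS NOT HERE (stated, not hidden): the discharge of `hUB1` (sequel), the `G`-half (V-GF), V-P ∕ V-REG, the coarse-level V-UB at level `k` (nested carriers), the END.

HONEST FRAMING (T4-DAG p. 1).  Instantiation only, at MODEL level (unitary bond operators DATA; taxi ∕ straight contours OURS; SHAPES only, no B0, c5); nothing printed is a
hypothesis; no `def`, no `def … : Prop`, no `sorry`; axioms standard.  NE2 NOT proved on either road; NE3 OPEN; spine PROVED 0∕9 unchanged; rung (B)+1 finite T⁴ — NOT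
infinite volume, NOT mass gap, NOT Clay.  HONEST DEPENDENCY (cell, verbatim): continuum YM on T⁴ ⇐ BetaPertH ∧ nine spine estimates (0/9 proved); BetaPertH ⇐ (D1) ∧ (D4) ∧
CAP+tail; G-an2-4 gates asym, D1 and NE2/3/4.
-/

noncomputable section

namespace Summit.QuantumFields.BalabanUV.T4Continuum.VariationalColourTaxiTransport

open Literature.MathematicalPhysics.QuantumFieldTheory.Balaban1983to89.B5Prop11Plancherel (Tor fine unitVec)
open Literature.MathematicalPhysics.QuantumFieldTheory.Balaban1983to89.B5Block118 (tstep bpt)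
open Summit.QuantumFields.BalabanUV.T4Continuum.VariationalTransfer (blockSpin)
open Summit.QuantumFields.BalabanUV.T4Continuum.VariationalColourFederbush (norm_le_one_of_mem_unitary)
open Summit.QuantumFields.BalabanUV.T4Continuum.VariationalVectorFederbush (lineT)
open Summit.QuantumFields.BalabanUV.T4Continuum.VectorBlockTrialForm (nsqV QvL)
open Summit.QuantumFields.BalabanUV.T4Continuum.VariationalVectorForm (ScV SfV qWV)
open Summit.QuantumFields.BalabanUV.T4Continuum.VariationalVectorInterpolant (frameT)
open Summit.QuantumFields.BalabanUV.T4Continuum.VariationalVectorOneStep (plaq)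
open Summit.QuantumFields.BalabanUV.T4Continuum.VariationalVectorOneStepPhys (rhoV)
open Summit.QuantumFields.BalabanUV.T4Continuum.VariationalVectorOneStepRepair (blockSpin_QT_le)

variable {d : ℕ} {E : Type*} [NormedAddCommGroup E] [InnerProductSpace ℂ E]

/-! ## §1 Bałaban's product line transports against the frame-adapted transports, at taxi frames -/

section Frames

variable (L : ℕ) [NeZero L] (N : Fin d → ℕ) [hN : ∀ μ, NeZero (N μ)]

/-- **LINE vs FRAME AT TAXI DATA**: `‖lineT (taxiTv R′) R′ (y,j,t,ν) − frameT (taxiTv R′) (coarseTv R′) (y,j,t,ν)‖ ≤ 3·(d−1)L(L−1)·a` — leaf-01-g6's `frameT` is `taxiTv R′ p`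
on own positions and `coarseTv R′ (y,ν) ∘ taxiTv R′ p` on spill positions; part 2's `lineT_taxi_own_sub_le` ∕ `lineT_taxi_spill_sub_le`. [folklore] -/
theorem lineT_sub_frameT_taxi_le {R' : Tor (fine L N) → Fin d → (E →L[ℂ] E)} (hR' : ∀ x μ, ‖R' x μ‖ ≤ 1) {a : ℝ}
    (ha : ∀ x κ ι, ‖R' x κ * R' (x + unitVec (fine L N) κ) ι - R' x ι * R' (x + unitVec (fine L N) ι) κ‖ ≤ a)
    (y : Tor N) (j : Fin d → Fin L) (t : Fin L) (ν : Fin d) :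
    ‖lineT L N (taxiTv L N R') R' y j t ν - frameT L N (taxiTv L N R') (coarseTv L N R') y j t ν‖ ≤ 3 * (((d - 1 : ℕ) : ℝ) * L * ((L - 1 : ℕ) : ℝ) * a) := by
  have ha0 : 0 ≤ a := (norm_nonneg _).trans (ha (bpt L N y j) ν ν)
  have h0 : 0 ≤ ((d - 1 : ℕ) : ℝ) * L * ((L - 1 : ℕ) : ℝ) * a := by positivity
  unfold frameT
  split_ifs with h
  · exact (lineT_taxi_own_sub_le L N hR' ha y j t ν h).trans (by nlinarith)
  · exact lineT_taxi_spill_sub_le L N hR' ha y j t ν (not_lt.mp h)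

end Frames

/-! ## §2 The `hONE` binder at taxi data -/

section One

variable [CompleteSpace E] (n L : ℕ) [NeZero n] [NeZero L] (M : Fin d → ℕ) [hM : ∀ μ, NeZero (M μ)]

/-- **THE `hONE` BINDER OF THE VECTOR BRACKET AT BAŁABAN's TAXI DATA, leaf V-UB for the carrier DISPLAYED** — leaf-01-g6's `blockSpin_QT_le` with every TRANSPORT
binder discharged: `U′ := taxiTv R′` (unitary frames), `Rc := coarseTv R′` (unitary, plaquette defect `p = L²a`), `hin`∕`hcross` with `m = (d−1)(L−1)(2L−1)a`,
`‖T − frameT‖ ≤ γ = 3(d−1)L(L−1)a`; `hUB1` (V-UB for `T = lineT (taxiTv R′) R′`, constant `Λ₁`) displayed in the tree's shape. [folklore] -/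
theorem blockSpin_lineT_taxi_le_of_ub [FiniteDimensional ℂ E] {R' : Tor (fine L (fine n M)) → Fin d → (E →L[ℂ] E)}
    (hU : ∀ x μ, R' x μ ∈ unitary (E →L[ℂ] E)) {a : ℝ} (ha0 : 0 ≤ a)
    (ha : ∀ x κ ι, ‖R' x κ * R' (x + unitVec (fine L (fine n M)) κ) ι - R' x ι * R' (x + unitVec (fine L (fine n M)) ι) κ‖ ≤ a)
    {G : (Tor (fine n M) → Fin d → E) → ℝ} (hG0 : ∀ W, 0 ≤ G W) {G' : (Tor (fine L (fine n M)) → Fin d → E) → ℝ} (hG0' : ∀ W', 0 ≤ G' W')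
    {Λ₁ : ℝ} (hΛ₁ : 0 ≤ Λ₁)
    (hUB1 : ∀ r : Tor (fine n M) → Fin d → E, ∃ g : Tor (fine L (fine n M)) → Fin d → E,
      QvL L (fine n M) (lineT L (fine n M) (taxiTv L (fine n M) R') R') g = r ∧ ScV L (fine n M) R' G' g ≤ Λ₁ * nsqV (fine n M) r)
    (W : Tor (fine n M) → Fin d → E) :
    blockSpin (QvL L (fine n M) (lineT L (fine n M) (taxiTv L (fine n M) R') R')) (SfV n L M R' (fun _ => 0)) W
      ≤ (Real.sqrt (ScV n M (coarseTv L (fine n M) R') G W + 4 * ((d : ℝ) + 26) * ((L : ℝ) / (n : ℝ) ^ 2) * rhoV n M (coarseTv L (fine n M) R') W)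
          + ((n : ℝ) * L * Real.sqrt (d * (50 * ((L : ℝ) * L * a) ^ 2 / L
                + (32 * (1 + (d : ℝ) ^ 2) + 400) * (((d - 1 : ℕ) : ℝ) * ((L - 1 : ℕ) : ℝ) * ((2 * L - 1 : ℕ) : ℝ) * a) ^ 2) / 2)
              + (n : ℝ) * (3 * (((d - 1 : ℕ) : ℝ) * L * ((L - 1 : ℕ) : ℝ) * a)) * Real.sqrt (Λ₁ * (4 * (1 + (d : ℝ) ^ 2) + 50)))
            * Real.sqrt (qWV n M W)) ^ 2 := by
  have hR' : ∀ x μ, ‖R' x μ‖ ≤ 1 := fun x μ => norm_le_one_of_mem_unitary (hU x μ)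
  have hmono : ((d - 1 : ℕ) : ℝ) * ((L - 1 : ℕ) : ℝ) * a ≤ ((d - 1 : ℕ) : ℝ) * ((L - 1 : ℕ) : ℝ) * ((2 * L - 1 : ℕ) : ℝ) * a := by
    have h1 : (1 : ℝ) ≤ ((2 * L - 1 : ℕ) : ℝ) := by have := NeZero.pos L; exact_mod_cast (show 1 ≤ 2 * L - 1 by omega)
    have h0 : 0 ≤ ((d - 1 : ℕ) : ℝ) * ((L - 1 : ℕ) : ℝ) * a := by positivity
    nlinarith
  exact blockSpin_QT_le n L M (U' := taxiTv L (fine n M) R') (Rc := coarseTv L (fine n M) R') (taxiTv_mem_unitary L (fine n M) hU)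
    (coarseTv_mem_unitary L (fine n M) hU) (by positivity)
    (fun y j μ h => (hin_taxiTv_le L (fine n M) hU ha y j μ h).trans hmono) (fun y j μ h => hcross_taxiTv_le L (fine n M) hU ha y j μ h)
    (fun y μ ν => coarseTv_plaq_le L (fine n M) hR' ha y μ ν) hG0 hG0' (by positivity) (lineT_sub_frameT_taxi_le L (fine n M) hR' ha) hΛ₁ hUB1 W

end One

end Summit.QuantumFields.BalabanUV.T4Continuum.VariationalColourTaxiTransport

end
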